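import Literature.NumberTheory.EllipticCurves.Kato2004.LocPKummerLog
import Literature.NumberTheory.EllipticCurves.Isogeny
import HarnessLib

/-!
# Dokchitser–Dokchitser 2015, §4 «Differentials», Lemma 10 (1)–(2) and Lemma 11 read on the tree's `padicLogLocal`:
# along a `ℚ`-isogeny pair of degree prime to `p` between globally minimal models, the `ℤ_p`-DUAL of the
# log-lattice `𝓛_W := ℤ_p·log_ω(W(ℚ_p)) ⊂ ℚ_p` is unchanged — ONE named fact (T-A2)′

Topic `NumberTheory/EllipticCurves`, sub-directory `DokchitserDokchitser2015` (namespace = path).  Cell bsd-cm, seat bsd-cm-k-ty1 g36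
(literature-prover; pen D1160 (5) «(T-A2)», critic idea-crit-15 NOTE #31; STEP 2b report STATUS 2026-08-31T15:54Z).  ONE named PUBLISHED
fact (`def … : Prop`, D-0014: nothing asserted, no `_holds`; +1 declared debt), no other declaration; no `sorry`, no instance, no notation,
no new notion (`WeierstrassCurve.Isogeny`, `Kato2004.padicLogLocal` are the tree's).

## Why (the consumer; nothing of it asserted here)

The Néron normalisation clause (A2) of `Kato2004.IsAdmissibleZetaClass` / `CM.kato15161_ellipticUnitClass_res_zetaFamily(_exact)`
(F-P1 / F-P1-EXACT) reads `∀ a, (∃ η, expStarCoord W d η = a) ↔ ∀ Q : W(ℚ_p), ‖a · padicLogLocal W p Q‖ ≤ 1`: its right-hand side is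
the `ℤ_p`-dual of `𝓛_W`.  At the `255³`-type members of `𝒞₇` the facts are fed at the maximal-order PARTNER `W₂` along the record's
`ℚ`-isogeny pair `(φ₀ : W → W₂, ψ₀ : W₂ → W, ψ₀ ∘ φ₀ = [e], e ∈ {1, 2})` (`PartnerTransport.exists_partner_isogenyPairRat`); the
left-hand side transports by kernel (`Kato2004/DefinedExpStarBodyIsogenyTransport.lean`, `expStarCoord_map_symm`, p825173), the
right-hand side needs `𝓛_{W₂} = u·𝓛_W`, `u ∈ ℤ_pˣ` — which the tree cannot derive today (`padicLogLocal` is the formal-group logarithm of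
THE MODEL on `(W.baseChange ℚ_[p])`-points; the tree's `Isogeny` acts on `K̄`-points only and has no formal-group incarnation; the
additivity `padicLogPoint_add` is itself a named fact).  This file supplies exactly that sentence, in print.

## The print (T. Dokchitser, V. Dokchitser, *Local invariants of isogenous elliptic curves*, Trans. Amer. Math. Soc. 367 (2015)
## 4339–4358 = arXiv:1208.5519; store `paper:arxiv-1208.5519`, re-read 2026-08-31: p0004 (§1.1 notation), p0007 (§4))

* §1.1 [p0004 L23–31]: "`p` is a prime number, and `φ : E → E′` an isogeny of elliptic curves of degree `p` … In §§3–6, the base field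
  `K` is a finite extension of `ℚ_l`; `l = p` is allowed"; "`ω, ω′` minimal differentials"; "`c, c′` Tamagawa numbers".
* **§4 Lemma 10** [Lemma 4.2 of TAMS; p0007 L10–33]: "(1) The isogeny `φ` induces a map on formal groups, `φ : Ê(𝔪_K) → Ê′(𝔪_K)`,
  `φ(T) = aT + ⋯`, with leading term `a = (φ^*ω′/ω) × unit ∈ O_K`.  (2) `|coker φ : E(K) → E′(K)| / |ker φ : E(K) → E′(K)| =
  |φ^*ω′/ω|_K⁻¹ · c′/c`."  Proof: "(1) By the Néron universal property, `φ` extends to a morphism of Néron models, and thus induces a map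
  on formal groups. For the leading term, see [Sil1] Ch. IV, especially Cor. IV.4.3.  (2) [Scha] Lemma 3.8" (= E. Schaefer, *Class groups
  and Selmer groups*, J. Number Theory 56 (1996), Lemma 3.8).
* **§4 Lemma 11** [p0007 L35–46]: "If `l ≠ p`, then `φ^*ω′` is minimal, so `|φ^*ω′/ω|_K = 1`.  Proof. Write `φ^*ω′ = aω`,
  `(φᵗ)^*ω = a′ω′` with `a, a′ ∈ O_K` by Lemma 10. Because `φᵗφ = [p]`, we have `aa′ = p ∈ O_Kˣ`. So `a` and `a′` are units."

ASSEMBLED FROM PRINTED LEMMAS — the four steps, with locators (pen D1166 (1); this is the text of record of the fact below).  Setting: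
`K = ℚ_p` (the paper's local field, residue characteristic `l = p` here), `W, W₂ / ℚ` globally minimal (so `ω_W`, `ω_{W₂}` are minimal
differentials at `p` — LOAD-BEARING for step 2 on BOTH sides), a `ℚ`-isogeny pair `φ₀ : W → W₂`, `ψ₀ : W₂ → W` with `ψ₀φ₀ = [e]` AND
`φ₀ψ₀ = [e]` (both compositions are used: the first in step 2, the second in step 4), `p ∤ e`; `𝓛_W := ℤ_p·log_ω(W(ℚ_p)) ⊂ ℚ_p` where
`log_ω = padicLogLocal W p = log_W(z(m₀•Q))/m₀`, `m₀ = formalIndex W p = [W(ℚ_p) : Ŵ(pℤ_p)]`, is the formal logarithm extended `ℤ`-linearly.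
  (1) [§4 Lemma 10 (1), p0007 L10–19, L28–31; SilvermanATAEC1994 IV.5.1 (Néron mapping property)] `φ₀` induces `φ̂₀ : Ŵ(𝔪) → Ŵ₂(𝔪)`,
      `φ̂₀(T) = aT + ⋯`, `a = (φ₀^*ω₂/ω)·(unit) ∈ ℤ_p`; likewise `ψ̂₀(T) = a′T + ⋯`.
  (2) [§4 Lemma 11, p0007 L35–46, its two-line proof with the paper's prime degree replaced by `e`] `φ̂₀ ∘ ψ̂₀` and `ψ̂₀ ∘ φ̂₀` are the
      formal multiplication by `e`, so `aa′ = e·(unit)`; `a, a′ ∈ ℤ_p` and `p ∤ e` ⇒ `a, a′ ∈ ℤ_pˣ` («`φ^*ω′` is minimal»).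
  (3) [SilvermanAEC2009 Cor. IV.4.3 «`ω_G ∘ f = f′(0)·ω_F`» and §IV.5 (the logarithm is the integral of the invariant differential)]
      `log_{W₂} ∘ φ̂₀ = a·log_W` on `Ŵ(pℤ_p)`; since `φ₀` is a group homomorphism on `W(ℚ_p)` and `log_ω` is the unique `ℤ`-linear extension,
      `log_{ω₂}(φ₀ Q) = a·log_ω(Q)` for all `Q ∈ W(ℚ_p)`, i.e. `log_{ω₂}(φ₀ W(ℚ_p)) = a·log_ω(W(ℚ_p))`.
  (4) [group theory; cf. §4 Lemma 10 (2) = Schaefer1996 Lemma 3.8 for the exact index, NOT needed] `φ₀ψ₀ = [e]` gives `e·W₂(ℚ_p) ⊆ φ₀(W(ℚ_p))`,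
      hence `e·𝓛_{W₂} ⊆ ℤ_p·log_{ω₂}(φ₀ W(ℚ_p)) = a·𝓛_W ⊆ 𝓛_{W₂}`; with `a, e ∈ ℤ_pˣ`: **`𝓛_{W₂} = 𝓛_W`** as `ℤ_p`-submodules of `ℚ_p`, so
      their `ℤ_p`-duals `{a : ∀ Q, ‖a·log_ω Q‖ ≤ 1}` and `{a : ∀ Q₂, ‖a·log_{ω₂} Q₂‖ ≤ 1}` COINCIDE — the statement below (the dual form is
      the one (A2) consumes; it is implied by, and for the `ℤ_p`-lines at hand equivalent to, `𝓛_{W₂} = 𝓛_W`).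
The tree's complex-side counterpart of steps (1)–(2) (the Néron scaling `α ∈ ℤ`, `α ∣ deg`, on period LATTICES) is
`exists_int_eq_and_dvd_of_neronScaling` (`IsogenyNeronScalingMinimalDiscriminantDirectionProofs.lean`); the `p`-adic formal-group side has
no tree precedent (`padicLogLocal` has no isogeny lemma; `WeierstrassCurve.Isogeny` acts on `K̄`-points only).

WHAT THIS IS NOT: not the pointwise functoriality `log_{ω₂}(φ₀ Q) = a·log_ω(Q)` (no map on `ℚ_p`-points attached to an `Isogeny` exists in
the tree to state it); not a point map `W(ℚ_p) → W₂(ℚ_p)`; not the value of `a = φ₀^*ω₂/ω`; not Lemma 10 (2)'s Tamagawa quotient `c′/c`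
nor the exact index `[W₂(ℚ_p) : φ₀W(ℚ_p)]`; nothing for isogenies of degree divisible by `p` (where `𝓛` DOES move, Thm. 1/Table 1 of the
paper); nothing about BSD; no summit statement touched; 19945 OPEN.
CHEAPEST FALSIFIER (registered, not run — kit 0): the 2-isogeny 49a1 `[1,−1,0,−2,−1]` ↔ 49a2 `[1,−1,0,−37,−78]` at `p = 7` (both additive
at 7, `m₀ = #W̃_ns(𝔽₇)·c₇ = 7·c₇`): compute `𝓛 = (1/m₀)·ℤ₇·log(m₀·E(ℚ₇))` on both sides from the formal-group series to precision `O(7^6)` and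
compare the two `ℤ₇`-lines; any pair of `𝒞₇` members `E_{D,1} ↔ E_{D,2}` serves equally.

HONEST LABEL / SCOPE: a transcription of Lemma 10 (1)–(2) + Lemma 11 specialised to `K = ℚ_p`, isogenies over `ℚ` of degree prime
to `p`, read on the tree's `padicLogLocal`; the Tamagawa quotient `c′/c` of Lemma 10 (2) is not transcribed (only `e·W₂(ℚ_p) ⊆
φ₀W(ℚ_p)` is used); nothing about `φ^*ω′/ω` as a number is exported (no map on `ℚ_p`-points exists in the tree to carry it).
Nothing about BSD; no summit statement touched; 19945 OPEN.
-- TODO(general form): `K` a finite extension of `ℚ_l`; the leading term `a = φ^*ω′/ω` itself once `Isogeny` acts on `K`-points /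
-- formal groups; Lemma 10 (2) with the Tamagawa numbers.

## References
* [DokchitserDokchitser2015LocalInvariants] T. Dokchitser, V. Dokchitser, Trans. Amer. Math. Soc. 367 (2015) 4339–4358 (arXiv:1208.5519),
  §1.1, §4 Lemma 10 (1)–(2), Lemma 11.
* [Schaefer1996] E. F. Schaefer, *Class groups and Selmer groups*, J. Number Theory 56 (1996), Lemma 3.8.
* [SilvermanAEC2009] J. H. Silverman, *The Arithmetic of Elliptic Curves*, Cor. IV.4.3, §IV.5 (formal logarithm), VII.2.2.
* [SilvermanATAEC1994] J. H. Silverman, *Advanced Topics*, IV.5.1 (Néron mapping property), Cor. IV.9.1–9.2.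
* Tree: `Kato2004/LocPKummerLog.lean` (`padicLogLocal`, l.167), `Isogeny.lean` (`WeierstrassCurve.Isogeny`),
  `Kato2004/DefinedExpStarBodyIsogenyTransport.lean` (the LHS transport), `Kato2004/EllipticUnitZetaClassComparisonExact.lean` (consumer's (A2)).
-/

noncomputable section

open WeierstrassCurve

namespace Literature.NumberTheory.EllipticCurves.DokchitserDokchitser2015

/-- **Dokchitser–Dokchitser 2015, §4 Lemma 10 (1)–(2) and Lemma 11, read on `padicLogLocal` — (T-A2)′: the `ℤ_p`-dual of the
log-lattice is invariant along a `ℚ`-isogeny pair of degree prime to `p`.**  For globally minimal `W, W₂ / ℚ`, a `ℚ`-isogeny pair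
`φ₀ : W → W₂`, `ψ₀ : W₂ → W` with `ψ₀ ∘ φ₀ = [e]` and `φ₀ ∘ ψ₀ = [e]`, and a prime `p ∤ e`:
`{a ∈ ℚ_p : ∀ Q ∈ W(ℚ_p), ‖a · log_ω(Q)‖ ≤ 1} = {a ∈ ℚ_p : ∀ Q₂ ∈ W₂(ℚ_p), ‖a · log_{ω₂}(Q₂)‖ ≤ 1}` (`log_ω = padicLogLocal W p`,
the formal-group logarithm of the minimal model extended to `E(ℚ_p)`).  CONTENT: Lemma 10 (1) («`φ` induces `φ̂(T) = aT + ⋯` on formal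
groups, `a = (φ^*ω′/ω)×unit ∈ O_K`», with AEC IV.4.3: `log_{ω₂} ∘ φ̂₀ = a·log_ω`), Lemma 11 («`aa′ = deg ∈ O_Kˣ` ⇒ `a` a unit» for
degree prime to the residue characteristic), and `e·W₂(ℚ_p) ⊆ φ₀(W(ℚ_p))`: `𝓛_{W₂} ⊇ a·𝓛_W ⊇ e·𝓛_{W₂}` with `a, e ∈ ℤ_pˣ`.  Stated for
`K = ℚ_p` and `ℚ`-isogenies (the consumer's case); named fact; nothing asserted; no `_holds` expected (the tree has no formal-group
incarnation of `Isogeny`).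
[cite: DokchitserDokchitser2015LocalInvariants, §4 Lemma 10 (1)–(2) and Lemma 11 (arXiv:1208.5519 p. 7)] [cite: Schaefer1996, Lemma 3.8]
[cite: SilvermanAEC2009, Cor. IV.4.3 and §IV.5] [cite: SilvermanATAEC1994, IV.5.1] -/
def padicLogLocal_dual_eq_of_isogenyPair_coprime : Prop :=
  ∀ (W W₂ : WeierstrassCurve ℚ) [W.IsElliptic] [W.IsGloballyMinimal] [W₂.IsElliptic] [W₂.IsGloballyMinimal]
    (φ₀ : Isogeny W W₂) (ψ₀ : Isogeny W₂ W) (e : ℤ),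
    (∀ P : W.geomPoints, ψ₀ (φ₀ P) = e • P) → (∀ Q : W₂.geomPoints, φ₀ (ψ₀ Q) = e • Q) →
  ∀ (p : ℕ) [Fact p.Prime], ¬ (p : ℤ) ∣ e →
  ∀ a : ℚ_[p],
    (∀ Q : (W.baseChange ℚ_[p]).toAffine.Point, ‖a * Kato2004.padicLogLocal W p Q‖ ≤ 1) ↔
      (∀ Q₂ : (W₂.baseChange ℚ_[p]).toAffine.Point, ‖a * Kato2004.padicLogLocal W₂ p Q₂‖ ≤ 1)

end Literature.NumberTheory.EllipticCurves.DokchitserDokchitser2015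

end
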